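import Summits.FinalStateConjecture.FinalStateConjecture.Theses.EIHFluxBalance

/-!
# Sketch — first lemmas of the two crux ideas of ideator 2 (round 1) for
# `EIHFluxBalance.ModulatedKerrHandoff` (item stmt-FinalStateConjecture-17402)

* `TameTemplate.trimFlat_not_isImmersedAtZero` — a one-parameter family of data that is, point by
  point, EVENTUALLY CONSTANT in the parameter near `c = 0` (the shape of every receding trimming /
  receding modification family) is NOT immersed at `0`; hence tame witnesses for H′ must carry a
  compactly supported immersed direction (gauge breathing) on top of any trimming (card
  `tame-template-breathe-trim-kick`). PROVED below.
* `ConeRatesAreILED.LieDragResponseDecay` — the flat-space forced response to the receding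
  superposition defect (source `≤ A t⁻² Σ± (M + |x ∓ ½vt e₁|)⁻²` supported in the lab cone
  `|x| ≤ κ t`) is `O(A log(1+t) / t²)` in the cone, i.e. below H′'s weight `t^{-7/4}` (card
  `cone-rates-are-iled`). Stated only (def Prop).
-/

set_option linter.dupNamespace false

noncomputable section

open scoped Topology Manifold ContDiff BigOperators
open Filter Set Literature.Geometry.Lorentzian

namespace Summit.FinalStateConjecture.FinalStateConjecture.Cruxes.ModulatedKerrHandoff

namespace TameTemplate

variable {X : Type*} [TopologicalSpace X] [ChartedSpace E3 X] [IsManifold (𝓡 3) ∞ X]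

/-- **Receding / eventually-constant families are flat at the base point.** If for every point
`x` the components `(F c).h x`, `(F c).k x` agree with those of `F 0` for all `c` near `0`
(e.g. `F c = d` on the ball of radius `1/‖c‖`, the receding Kerr-end trimming), then `F` is not
immersed at `0` in the sense of `InitialDataSet.IsImmersedAtZero` (all parameter derivatives of all
scalar components vanish at `c = 0`). Consequence for the crux: tameness forces receding trimming
(wDist-continuity at `0`), trimming is flat, so the immersed direction of a tame witness must come
from elsewhere — a compactly supported gauge-breathing or kick direction. [folklore] -/
theorem trimFlat_not_isImmersedAtZero (F : EuclideanSpace ℝ (Fin 1) → InitialDataSet (𝓡 3) X)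
    (hF : ∀ x : X, ∀ᶠ c in 𝓝 (0 : EuclideanSpace ℝ (Fin 1)),
      (F c).h.inner x = (F 0).h.inner x ∧ (F c).k x = (F 0).k x) :
    ¬ InitialDataSet.IsImmersedAtZero 1 F := by
  intro himm
  obtain ⟨x, u, w, huw⟩ := himm (EuclideanSpace.single (0 : Fin 1) (1 : ℝ)) (by simp)
  have h1 : (fun c ↦ (F c).h.inner x u w) =ᶠ[𝓝 0] fun _ ↦ (F 0).h.inner x u w :=
    (hF x).mono fun c hc ↦ by simp [hc.1]
  have h2 : (fun c ↦ (F c).k x u w) =ᶠ[𝓝 0] fun _ ↦ (F 0).k x u w :=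
    (hF x).mono fun c hc ↦ by simp [hc.2]
  rcases huw with h | h
  · exact h (by rw [h1.fderiv_eq]; simp)
  · exact h (by rw [h2.fderiv_eq]; simp)

/-- The Prop form of the lemma above (for citation in the card). -/
def TrimFlatNotImmersed : Prop :=
  ∀ (Y : Type) [TopologicalSpace Y] [ChartedSpace E3 Y] [IsManifold (𝓡 3) ∞ Y]
    (F : EuclideanSpace ℝ (Fin 1) → InitialDataSet (𝓡 3) Y),
    (∀ y : Y, ∀ᶠ c in 𝓝 (0 : EuclideanSpace ℝ (Fin 1)),
      (F c).h.inner y = (F 0).h.inner y ∧ (F c).k y = (F 0).k y) →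
    ¬ InitialDataSet.IsImmersedAtZero 1 F

theorem trimFlatNotImmersed_holds : TrimFlatNotImmersed :=
  fun _ _ _ _ F hF ↦ trimFlat_not_isImmersedAtZero F hF

end TameTemplate

namespace ConeRatesAreILED

/-- Unit vector `e₁` of `E3`. -/
def e₁ : E3 := EuclideanSpace.single 0 1

/-- **Forced response to the receding superposition defect decays like `log t / t²` in the lab
cone** (flat model of the first brick of card `cone-rates-are-iled`). Let `0 < M`, `0 < v < κ < 1`,
`0 ≤ A`. There is `C` such that: for every `C²` function `u` on `[1, ∞) × ℝ³` (extended to all `t`)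
with ZERO Cauchy data at `t = 1`, solving the flat wave equation `∂ₜ²u − Δu = f` for `t ≥ 1` with a
continuous source supported in the lab cone `{‖x‖ ≤ κ t}` and bounded by the Lie-drag-corrected
two-centre defect profile `|f(t,x)| ≤ A t⁻² Σ± (M + ‖x ∓ (vt/2) e₁‖)⁻²` (separation `D(t) = vt`,
`A ~ M²/v²` — overlap card's `Ric[G⁺] ≍ M²/(D²d²)`), one has `|u(t,x)| ≤ C A log(1+t)/t²` for all
`t ≥ 1`, `‖x‖ ≤ κ t`. Mechanism: source and observer both lie inside the cone, so all retarded
times are `≥ (1−κ)t/(1+κ)`; Duhamel + the potential estimate `∫_{|y|≤κt}(M+|y∓c|)⁻²|x−y|⁻¹ dy ≲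
log(1 + κt/M)`. The bound is below H′'s weight `t^{-7/4}` (margin `t^{-1/4} log t`). [folklore] -/
def LieDragResponseDecay : Prop :=
  ∀ (A M v κ : ℝ), 0 ≤ A → 0 < M → 0 < v → v < κ → κ < 1 →
    ∃ C : ℝ, ∀ (u f : ℝ → E3 → ℝ),
      ContDiff ℝ 2 (fun p : ℝ × E3 ↦ u p.1 p.2) →
      Continuous (fun p : ℝ × E3 ↦ f p.1 p.2) →
      (∀ x, u 1 x = 0 ∧ deriv (fun s ↦ u s x) 1 = 0) →
      (∀ t x, 1 ≤ t →
        deriv (fun s ↦ deriv (fun s' ↦ u s' x) s) t =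
          ∑ i : Fin 3, deriv (fun s : ℝ ↦ deriv (fun s' : ℝ ↦ u t (x + s' • EuclideanSpace.single i (1 : ℝ))) s) (0 : ℝ)
            + f t x) →
      (∀ t x, 1 ≤ t → κ * t < ‖x‖ → f t x = 0) →
      (∀ t x, 1 ≤ t →
        |f t x| ≤ A * t⁻¹ ^ 2 * ((M + ‖x - (v * t / 2) • e₁‖)⁻¹ ^ 2 + (M + ‖x + (v * t / 2) • e₁‖)⁻¹ ^ 2)) →
      ∀ t x, 1 ≤ t → ‖x‖ ≤ κ * t → |u t x| ≤ C * A * Real.log (1 + t) / t ^ 2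

end ConeRatesAreILED

end Summit.FinalStateConjecture.FinalStateConjecture.Cruxes.ModulatedKerrHandoff

end
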